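import Summits.ValiantsHypothesis.ValiantsHypothesis.Theorems.SymmetroidDescartesDerivedPencilRolleStairGadget

/-!
# Route SymmetroidDescartes — refutation of `DerivedPencilRolle` (stmt-ValiantsHypothesis-18500):
the staircase family — rows, cells, the decision lemma and the two numerical conditions

Rows step up by at most one per layer; geometry of the nested cells (`InCore` of a child cell
implies `InCore` of its parent); the DECISION LEMMA at a staircase (`fval_gap`: in the core of a cell,
every wrong digit costs at least `P_{k+1} hw_{k+2}` more) and the VARIATION LEMMA (`fval_var`); the
numerical conditions (C1) `cond_small` and (C2) `cond_gap` on the quanta `P_k = Q^{L+1-k}`,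
`Q = 2^{L+3}(n+2)^{L+1}`.
-/

-- single-conjunct layout: Sub = Summit, duplicated namespace component intended
set_option linter.dupNamespace false

namespace Summit.ValiantsHypothesis.ValiantsHypothesis.Theorems.SymmetroidDescartes.DPR

open scoped BigOperators

section
variable (n L : ℕ)

/-- Through layers with `RowStep`, a finite-cost walk ends in a row between the starting row and the
starting row plus the number of layers. [folklore] -/
theorem row_bounds_of_rowStep {K : ℕ} (d : Fin K → ℕ) (lam : ℤ) :
    ∀ (g : List (WLayer (ℕ × Bool) K)), (∀ l ∈ g, RowStep l) → ∀ (v : ℕ × Bool) (w : List (ℕ × Bool)),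
      walkCost d lam g v w ≠ ⊤ → v.1 ≤ (walkLast v w).1 ∧ (walkLast v w).1 ≤ v.1 + g.length
  | [], _, v, [], _ => by simp
  | [], _, _, _ :: _, h => by simp at h
  | _ :: _, _, _, [], h => by simp at h
  | l :: g, hg, v, v' :: w, h => by
      rw [walkCost_cons_cons, WithTop.add_ne_top] at h
      have hl : RowStep l := hg l (by simp)
      have hstep : v.1 ≤ v'.1 ∧ v'.1 ≤ v.1 + 1 := by
        cases hv : l v v' with
        | none => rw [hv] at h; exact absurd rfl h.1
        | some e => exact hl v v' e hv
      have ih := row_bounds_of_rowStep d lam g (fun l' hl' => hg l' (by simp [hl'])) v' w h.2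
      rw [walkLast_cons, List.length_cons]
      omega

/-- Every layer of a staircase has `RowStep`. [folklore] -/
theorem rowStep_stairJ (k : ℕ) (p : ℤ) : ∀ l ∈ stairJ n L k p, RowStep l := by
  intro l hl
  simp only [stairJ, List.mem_cons, List.mem_append, List.not_mem_nil, or_false] at hl
  rcases hl with rfl | hl | rfl
  · intro v v' e he
    simp only [entryLayer] at he
    split_ifs at he with h
    · omega
  · -- a climb layer
    suffices ∀ m s0, l ∈ climbs n L k p s0 m → RowStep l from this _ _ hl
    intro m
    induction m with
    | zero => intro s0 h; simp at h
    | succ m ih =>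
        intro s0 h
        rw [climbs_succ, List.mem_cons] at h
        rcases h with rfl | h
        · intro v v' e he
          simp only [climbLayer] at he
          split_ifs at he with h1 h2 <;> omega
        · exact ih _ h
  · intro v v' e he
    simp only [exitLayer] at he
    split_ifs at he with h
    · omega

/-- Every layer of `𝒢_k(p)` has `RowStep`. [folklore] -/
theorem rowStep_gad : ∀ (k : ℕ) (p : ℤ), ∀ l ∈ gad n L k p, RowStep l
  | 0, _ => by simp [gad]
  | k + 1, p => by
      intro l hl
      rw [gad, List.mem_append, List.mem_append] at hl
      rcases hl with hl | hl | hl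
      · exact rowStep_gad k _ l hl
      · exact rowStep_stairJ n L _ _ l hl
      · exact rowStep_gad k _ l hl

/-- The exit shift is at most the number of layers: `σ_k(j) ≤ (2^k − 1)(n + 1)` (`n ≥ 1`).
[folklore] -/
theorem sig_le (hn : 1 ≤ n) : ∀ (k j : ℕ), sig n k j ≤ (2 ^ k - 1) * (n + 1)
  | 0, _ => by simp [sig]
  | k + 1, j => by
      rw [sig, pow_succ]
      have h1 := sig_le hn k (j / n)
      have h2 : j % n + 1 ≤ n := Nat.mod_lt j hn
      have h3 : 1 ≤ 2 ^ k := Nat.one_le_two_pow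
      generalize j % n = r at h2 ⊢
      generalize sig n k (j / n) = σ at h1 ⊢
      generalize 2 ^ k = A at h1 h3 ⊢
      zify [h3, (by omega : 1 ≤ A * 2)] at h1 ⊢
      nlinarith

/-- Half-widths scale by `n + 2` from one level to the next (`k ≤ L`). [folklore] -/
theorem hw_succ (k : ℕ) (hk : k ≤ L) : hw n L k = (n + 2) * hw n L (k + 1) := by
  simp only [hw]
  rw [show L + 1 - k = (L + 1 - (k + 1)) + 1 by omega, pow_succ]
  ring

/-- Slope quanta scale by `Q` from one level to the next (`k ≤ L`). [folklore] -/
theorem slopeP_succ (k : ℕ) (hk : k ≤ L) : slopeP n L k = bigQ n L * slopeP n L (k + 1) := by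
  simp only [slopeP]
  rw [show L + 1 - k = (L + 1 - (k + 1)) + 1 by omega, pow_succ]
  ring

/-- `Q ≥ 2`. [folklore] -/
theorem two_le_bigQ : 2 ≤ bigQ n L := by
  have h1 : 2 ≤ 2 ^ (L + 3) := by
    calc 2 = 2 ^ 1 := rfl
      _ ≤ 2 ^ (L + 3) := Nat.pow_le_pow_right (by norm_num) (by omega)
  have h2 : 1 ≤ (n + 2) ^ (L + 1) := Nat.one_le_pow _ _ (by omega)
  calc 2 = 2 * 1 := rfl
    _ ≤ 2 ^ (L + 3) * (n + 2) ^ (L + 1) := Nat.mul_le_mul h1 h2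

/-- Half-widths are positive. [folklore] -/
theorem hw_pos (k : ℕ) : 0 < hw n L k := pow_pos (by omega) _

/-- Cells are nested inside the level-`0` cell: `α_k(j) + 2 hw_k ≤ 2 hw_0` (`k ≤ L + 1`, `n ≥ 1`).
[folklore] -/
theorem loc_add_le (hn : 1 ≤ n) : ∀ (k : ℕ), k ≤ L + 1 → ∀ (j : ℕ),
    loc n L k j + 2 * hw n L k ≤ 2 * hw n L 0
  | 0, _, _ => by simp [loc]
  | k + 1, hk, j => by
      rw [loc]
      have h1 := loc_add_le hn k (by omega) (j / n)
      have h2 := hw_succ n L k (by omega)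
      have h3 : j % n + 1 ≤ n := Nat.mod_lt j hn
      generalize j % n = r at h3 ⊢
      have h4 : hw n L (k + 1) * (r + 3) ≤ hw n L (k + 1) * (n + 2) :=
        Nat.mul_le_mul_left _ (by omega)
      nlinarith

/-- Cores are nested: the core of a level-`k+1` cell lies in the core of its parent (`k + 1 ≤ L`,
`n ≥ 1`). [folklore] -/
theorem inCore_parent (hn : 1 ≤ n) (k : ℕ) (hk : k + 1 ≤ L) (j : ℕ) (lam : ℤ)
    (h : InCore n L (k + 1) j lam) : InCore n L k (j / n) lam := by
  obtain ⟨h1, h2⟩ := h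
  unfold InCore at *
  rw [loc] at h1 h2
  have e1 := hw_succ n L k (by omega)
  have e2 := hw_succ n L (k + 1) hk
  have h3 : j % n + 1 ≤ n := Nat.mod_lt j hn
  generalize j % n = r at h1 h2 h3 ⊢
  have h4 : hw n L (k + 1) * (r + 3) ≤ hw n L (k + 1) * (n + 2) := Nat.mul_le_mul_left _ (by omega)
  have h5 : 0 ≤ hw n L (k + 1 + 1) := Nat.zero_le _
  constructor
  · push_cast at h1 ⊢
    have : (0 : ℤ) ≤ hw n L (k + 1) * r + hw n L (k + 2) := by positivity
    linarith
  · push_cast at h2 ⊢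
    zify at e1 h4 h5
    linarith

/-- The key identity behind the decision: the difference of `fval` between digits `r'` and `r`
factors through `r' − r`. [folklore] -/
theorem fval_sub (k : ℕ) (p : ℤ) (e r r' d : ℕ) (lam : ℤ) :
    fval n L k p e r' d lam - fval n L k p e r d lam
      = ((r' : ℤ) - r) * ((slopeP n L (k + 1) : ℤ) * hw n L (k + 1) * ((r' : ℤ) - r + 1)
          + p * e * (2 * hw n L (k + 1))
          - (slopeP n L (k + 1) : ℤ) * (lam - loc n L k d - 2 * hw n L (k + 1) * (1 + r))) := by
  simp only [fval, stairCost, val_cov n L lam k (slopeP n L (k + 1)) (e + r),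
    val_cov n L lam k (slopeP n L (k + 1)) (e + r')]
  push_cast
  ring

/-- DECISION LEMMA.  In the core of the level-`k+1` cell `j` (digit `r = j % n`, parent `d = j / n`),
if the perturbation `|p|·e·(2 hw_{k+1})` is at most `P_{k+1}·hw_{k+2}`, then every other digit
`r' ≠ r` costs at least `P_{k+1}·hw_{k+2}` more. [folklore] -/
theorem fval_gap (hn : 1 ≤ n) (k : ℕ) (hk : k + 1 ≤ L) (p : ℤ) (e j r' : ℕ) (lam : ℤ)
    (hcore : InCore n L (k + 1) j lam)
    (hsmall : |p| * e * (2 * hw n L (k + 1)) ≤ (slopeP n L (k + 1) : ℤ) * hw n L (k + 2))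
    (hne : r' ≠ j % n) :
    fval n L k p e (j % n) (j / n) lam + (slopeP n L (k + 1) : ℤ) * hw n L (k + 2)
      ≤ fval n L k p e r' (j / n) lam := by
  have key := fval_sub n L k p e (j % n) r' (j / n) lam
  obtain ⟨h1, h2⟩ := hcore
  rw [loc] at h1 h2
  have e2 := hw_succ n L (k + 1) hk
  have hr : j % n + 1 ≤ n := Nat.mod_lt j hn
  generalize j % n = r at key h1 h2 hr hne
  generalize j / n = d at key h1 h2
  set P : ℤ := (slopeP n L (k + 1) : ℤ) with hP
  set H1 : ℤ := (hw n L (k + 1) : ℤ) with hH1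
  set H2 : ℤ := (hw n L (k + 2) : ℤ) with hH2
  have hP0 : 0 ≤ P := by rw [hP]; positivity
  have hH2nn : 0 ≤ H2 := by rw [hH2]; positivity
  have hPH2 : 0 ≤ P * H2 := mul_nonneg hP0 hH2nn
  have hpe : -(P * H2) ≤ p * e * (2 * H1) ∧ p * e * (2 * H1) ≤ P * H2 := by
    have : |p * e * (2 * H1)| ≤ P * H2 := by
      rw [abs_mul, abs_mul, abs_of_nonneg (by positivity : (0 : ℤ) ≤ e),
        abs_of_nonneg (by rw [hH1]; positivity : (0 : ℤ) ≤ 2 * H1)]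
      exact hsmall
    exact abs_le.1 this
  push_cast at h1 h2
  have e2' : (H1 : ℤ) = (n + 2) * H2 := by rw [hH1, hH2]; exact_mod_cast e2
  -- θ := lam - loc d - 2 H1 (1 + r) ∈ [2 H2, 2 H1 - 2 H2]
  set θ : ℤ := lam - loc n L k d - 2 * H1 * (1 + r) with hθ
  have hθ1 : 2 * H2 ≤ θ := by rw [hθ]; linarith
  have hθ2 : θ ≤ 2 * H1 - 2 * H2 := by rw [hθ]; linarith
  set B : ℤ := P * H1 * ((r' : ℤ) - r + 1) + p * e * (2 * H1) - P * θ with hB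
  have hkey : fval n L k p e r' d lam - fval n L k p e r d lam = ((r' : ℤ) - r) * B := by
    rw [key, hB, hθ]
  rcases lt_or_gt_of_ne hne with hlt | hgt
  · -- r' < r : both factors are negative
    have hδ : (r' : ℤ) - r + 1 ≤ 0 := by
      have : r' + 1 ≤ r := hlt
      have : ((r' + 1 : ℕ) : ℤ) ≤ r := by exact_mod_cast this
      push_cast at this; linarith
    have hB1 : B + P * H2 ≤ 0 := by
      have h5 : P * H1 * ((r' : ℤ) - r + 1) ≤ 0 :=
        mul_nonpos_of_nonneg_of_nonpos (by positivity) hδ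
      have h6 : P * (2 * H2) ≤ P * θ := mul_le_mul_of_nonneg_left hθ1 hP0
      rw [hB]; linarith [hpe.2]
    have h7 : 0 ≤ (-(((r' : ℤ) - r)) - 1) * (-(B) - P * H2) := mul_nonneg (by linarith) (by linarith)
    have h8 : 0 ≤ (-(((r' : ℤ) - r)) - 1) * (P * H2) := mul_nonneg (by linarith) hPH2
    have e7 : (-(((r' : ℤ) - r)) - 1) * (-(B) - P * H2)
        = ((r' : ℤ) - r) * B + ((r' : ℤ) - r) * (P * H2) + B + P * H2 := by ring
    have e8 : (-(((r' : ℤ) - r)) - 1) * (P * H2) = -(((r' : ℤ) - r) * (P * H2)) - P * H2 := by ring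
    rw [e7] at h7
    rw [e8] at h8
    linarith
  · -- r' > r : both factors are positive
    have hδ : (1 : ℤ) ≤ (r' : ℤ) - r := by
      have : r + 1 ≤ r' := hgt
      have : ((r + 1 : ℕ) : ℤ) ≤ r' := by exact_mod_cast this
      push_cast at this; linarith
    have hB1 : P * H2 ≤ B := by
      have h5 : P * H1 * 2 ≤ P * H1 * ((r' : ℤ) - r + 1) :=
        mul_le_mul_of_nonneg_left (by linarith) (by positivity)
      have h6 : P * θ ≤ P * (2 * H1 - 2 * H2) := mul_le_mul_of_nonneg_left hθ2 hP0
      rw [hB]; linarith [hpe.1]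
    have h7 : 0 ≤ (((r' : ℤ) - r) - 1) * (B - P * H2) := mul_nonneg (by linarith) (by linarith)
    have e7 : (((r' : ℤ) - r) - 1) * (B - P * H2)
        = ((r' : ℤ) - r) * B - ((r' : ℤ) - r) * (P * H2) - B + P * H2 := by ring
    have h8 : 0 ≤ (((r' : ℤ) - r) - 1) * (P * H2) := mul_nonneg (by linarith) hPH2
    have e8 : (((r' : ℤ) - r) - 1) * (P * H2) = ((r' : ℤ) - r) * (P * H2) - P * H2 := by ring
    rw [e7] at h7
    rw [e8] at h8
    linarith

/-- VARIATION LEMMA.  Moving the entering row of the staircase from `e` to `e'` (both within `T` of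
each other) changes `fval` by at most `T · (|p|·(2 hw_{k+1})·n + P_{k+1}·(2 hw_0))`. [folklore] -/
theorem fval_var (hn : 1 ≤ n) (k : ℕ) (hk : k ≤ L + 1) (p : ℤ) (e e' r d T : ℕ) (lam : ℤ)
    (hr : r + 1 ≤ n) (he : e ≤ e' + T) (he' : e' ≤ e + T) :
    fval n L k p e r d lam
      ≤ fval n L k p e' r d lam + T * (|p| * (2 * hw n L (k + 1)) * n + slopeP n L (k + 1) * (2 * hw n L 0)) := by
  have key : fval n L k p e' r d lam - fval n L k p e r d lam
      = ((e' : ℤ) - e) * (p * (2 * hw n L (k + 1)) * (1 + r) + slopeP n L (k + 1) * loc n L k d) := by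
    simp only [fval, stairCost, val_cov n L lam k (slopeP n L (k + 1)) (e + r),
      val_cov n L lam k (slopeP n L (k + 1)) (e' + r)]
    push_cast
    ring
  have hloc : (loc n L k d : ℤ) ≤ 2 * hw n L 0 := by
    have := loc_add_le n L hn k hk d
    have : loc n L k d ≤ 2 * hw n L 0 := by omega
    exact_mod_cast this
  have hX : |p * (2 * hw n L (k + 1)) * (1 + r) + slopeP n L (k + 1) * loc n L k d|
      ≤ |p| * (2 * hw n L (k + 1)) * n + slopeP n L (k + 1) * (2 * hw n L 0) := by
    refine (abs_add_le _ _).trans (add_le_add ?_ ?_)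
    · rw [abs_mul, abs_mul, abs_of_nonneg (by positivity : (0 : ℤ) ≤ 2 * hw n L (k + 1)),
        abs_of_nonneg (by positivity : (0 : ℤ) ≤ 1 + r)]
      have : (1 : ℤ) + r ≤ n := by exact_mod_cast (by omega : 1 + r ≤ n)
      exact mul_le_mul_of_nonneg_left this (by positivity)
    · rw [abs_of_nonneg (by positivity)]
      exact mul_le_mul_of_nonneg_left hloc (by positivity)
  have hE : |(e' : ℤ) - e| ≤ T := by
    rw [abs_le]; constructor
    · have : (e : ℤ) ≤ e' + T := by exact_mod_cast he
      linarith
    · have : (e' : ℤ) ≤ e + T := by exact_mod_cast he'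
      linarith
  have hprod := abs_mul ((e' : ℤ) - e)
    (p * (2 * hw n L (k + 1)) * (1 + r) + slopeP n L (k + 1) * loc n L k d)
  have hle := mul_le_mul hE hX (abs_nonneg _) (by positivity)
  have hneg := neg_abs_le (((e' : ℤ) - e) *
    (p * (2 * hw n L (k + 1)) * (1 + r) + slopeP n L (k + 1) * loc n L k d))
  linarith

/-- `Q = 4 (n+2) Rtot`. [folklore] -/
theorem bigQ_eq : bigQ n L = 4 * (n + 2) * Rtot n L := by
  simp only [bigQ, Rtot, pow_succ]; ring

/-- Every gadget fits below the row bound: `(2^L − 1)(n+1) ≤ Rtot`. [folklore] -/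
theorem layers_le_Rtot : (2 ^ L - 1) * (n + 1) ≤ Rtot n L := by
  have h1 : 2 ^ L - 1 ≤ 2 ^ L := Nat.sub_le _ _
  have h2 : n + 1 ≤ 2 * (n + 2) ^ L ∨ L = 0 := by
    rcases Nat.eq_zero_or_pos L with h | h
    · exact Or.inr h
    · left
      calc n + 1 ≤ n + 2 := by omega
        _ ≤ (n + 2) ^ L := Nat.le_self_pow (by omega) _
        _ ≤ 2 * (n + 2) ^ L := by omega
  rcases h2 with h2 | h2
  · calc (2 ^ L - 1) * (n + 1) ≤ 2 ^ L * (2 * (n + 2) ^ L) := Nat.mul_le_mul h1 h2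
      _ = Rtot n L := by simp only [Rtot, pow_succ]; ring
  · subst h2; simp [Rtot]

/-- CONDITION (C1): the perturbation of the decision is small.  For `|p| ≤ 2 P_{k+2}` and a row
`e ≤ Rtot`: `|p| · e · (2 hw_{k+1}) ≤ P_{k+1} · hw_{k+2}` (`k + 1 ≤ L`). [folklore] -/
theorem cond_small (k : ℕ) (hk : k + 1 ≤ L) (p : ℤ) (hp : |p| ≤ 2 * slopeP n L (k + 2)) (e : ℕ)
    (he : e ≤ Rtot n L) :
    |p| * e * (2 * hw n L (k + 1)) ≤ (slopeP n L (k + 1) : ℤ) * hw n L (k + 2) := by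
  have e1 : slopeP n L (k + 1) = bigQ n L * slopeP n L (k + 2) := slopeP_succ n L (k + 1) hk
  have e2 : hw n L (k + 1) = (n + 2) * hw n L (k + 2) := hw_succ n L (k + 1) hk
  have e3 := bigQ_eq n L
  have he' : (e : ℤ) ≤ Rtot n L := by exact_mod_cast he
  calc |p| * e * (2 * hw n L (k + 1))
      ≤ (2 * slopeP n L (k + 2)) * Rtot n L * (2 * hw n L (k + 1)) := by
        gcongr
    _ = (slopeP n L (k + 1) : ℤ) * hw n L (k + 2) := by
        rw [e1, e2, e3]; push_cast; ring

/-- The arithmetic behind condition (C2): `1 + 2^k (n+1)(4n + 2(n+2)^(k+1)) ≤ Q` (`k + 1 ≤ L`).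
[folklore] -/
theorem cond_gap_arith (k : ℕ) (hk : k + 1 ≤ L) :
    1 + 2 ^ k * (n + 1) * (4 * n + 2 * (n + 2) ^ (k + 1)) ≤ bigQ n L := by
  set B := (n + 2) ^ (k + 1) with hB
  have a1 : n ≤ B := le_trans (by omega : n ≤ n + 2) (Nat.le_self_pow (by omega) _)
  have a3 : 2 ^ k * (n + 1) * (4 * n + 2 * B) ≤ 2 ^ k * (n + 2) * (6 * B) :=
    Nat.mul_le_mul (Nat.mul_le_mul_left _ (by omega)) (by omega)
  have a4 : 1 ≤ 2 ^ k * (n + 2) * B := by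
    have : 1 ≤ 2 ^ k := Nat.one_le_two_pow
    have : 1 ≤ B := Nat.one_le_pow _ _ (by omega)
    calc 1 = 1 * 1 * 1 := rfl
      _ ≤ 2 ^ k * (n + 2) * B := Nat.mul_le_mul (Nat.mul_le_mul ‹1 ≤ 2 ^ k› (by omega)) ‹1 ≤ B›
  have a5 : 2 ^ k * (n + 2) * (8 * B) = 2 ^ (k + 3) * (n + 2) ^ (k + 2) := by
    rw [hB]; ring
  have a6 : 2 ^ (k + 3) * (n + 2) ^ (k + 2) ≤ bigQ n L :=
    Nat.mul_le_mul (Nat.pow_le_pow_right (by omega) (by omega))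
      (Nat.pow_le_pow_right (by omega) (by omega))
  have a7 : 1 + 2 ^ k * (n + 2) * (6 * B) ≤ 2 ^ k * (n + 2) * (8 * B) := by
    have : 2 ^ k * (n + 2) * (8 * B) = 2 ^ k * (n + 2) * (6 * B) + 2 * (2 ^ k * (n + 2) * B) := by ring
    omega
  omega

/-- CONDITION (C2): the margin of a child dominates the next gap plus the variation:
`P_{k+1} hw_{k+2} + T (2P_{k+2} · 2hw_{k+1} · n + P_{k+1} · 2hw_0) ≤ P_k hw_{k+1}` for
`T ≤ 2^k (n+1)` and `k + 1 ≤ L`. [folklore] -/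
theorem cond_gap (k : ℕ) (hk : k + 1 ≤ L) (T : ℕ) (hT : T ≤ 2 ^ k * (n + 1)) :
    (slopeP n L (k + 1) : ℤ) * hw n L (k + 2)
        + T * ((2 * slopeP n L (k + 2)) * (2 * hw n L (k + 1)) * n + slopeP n L (k + 1) * (2 * hw n L 0))
      ≤ slopeP n L k * hw n L (k + 1) := by
  have e0 : slopeP n L k = bigQ n L * slopeP n L (k + 1) := slopeP_succ n L k (by omega)
  have e1 : slopeP n L (k + 1) = bigQ n L * slopeP n L (k + 2) := slopeP_succ n L (k + 1) hk
  have e2 : hw n L (k + 1) = (n + 2) * hw n L (k + 2) := hw_succ n L (k + 1) hk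
  have e3 : hw n L 0 = (n + 2) ^ (k + 1) * hw n L (k + 1) := by
    simp only [hw]
    rw [← pow_add]; congr 1; omega
  have hQ := cond_gap_arith n L k hk
  have hQ1 : 1 ≤ bigQ n L := le_trans (by norm_num) (two_le_bigQ n L)
  -- work in ℕ
  suffices h : slopeP n L (k + 1) * hw n L (k + 2)
      + T * ((2 * slopeP n L (k + 2)) * (2 * hw n L (k + 1)) * n + slopeP n L (k + 1) * (2 * hw n L 0))
        ≤ slopeP n L k * hw n L (k + 1) by exact_mod_cast h
  set P1 := slopeP n L (k + 1)
  set P2 := slopeP n L (k + 2)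
  set h1 := hw n L (k + 1)
  set h2 := hw n L (k + 2)
  set B := (n + 2) ^ (k + 1)
  set Q := bigQ n L
  have hP2 : P2 ≤ P1 := by rw [e1]; exact Nat.le_mul_of_pos_left _ hQ1
  have hh2 : h2 ≤ h1 := by rw [e2]; exact Nat.le_mul_of_pos_left _ (by omega)
  calc P1 * h2 + T * (2 * P2 * (2 * h1) * n + P1 * (2 * hw n L 0))
      ≤ P1 * h1 + (2 ^ k * (n + 1)) * (2 * P1 * (2 * h1) * n + P1 * (2 * (B * h1))) := by
        rw [e3]; gcongr
    _ = P1 * h1 * (1 + 2 ^ k * (n + 1) * (4 * n + 2 * B)) := by ring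
    _ ≤ P1 * h1 * Q := Nat.mul_le_mul_left _ hQ
    _ = slopeP n L k * hw n L (k + 1) := by rw [e0]; ring

end

/-- Registered stub of this file: condition (C2) on the quanta. [folklore] -/
theorem stub_stairCells : ∀ (n L k : ℕ), k + 1 ≤ L → ∀ (T : ℕ), T ≤ 2 ^ k * (n + 1) → (slopeP n L (k + 1) : ℤ) * hw n L (k + 2) + T * ((2 * slopeP n L (k + 2)) * (2 * hw n L (k + 1)) * n + slopeP n L (k + 1) * (2 * hw n L 0)) ≤ slopeP n L k * hw n L (k + 1) :=
  fun n L k hk T hT => cond_gap n L k hk T hT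


end Summit.ValiantsHypothesis.ValiantsHypothesis.Theorems.SymmetroidDescartes.DPR
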